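import Summits.QuantumFields.YangMills.Theorems.UnitScaleTiltProp7DivSliceOfMemberDivSq
import Summits.QuantumFields.YangMills.Theorems.UnitScaleTiltProp7CurvedJunctionCovariance
import HarnessLib

/-!
# Route `UnitScaleTilt`, crux K1 «MinimiserStabilityRegPr» (stmt-QuantumFields-19200), EX row `hGF` (curved member), the LOD line (★p1 g24 `LOCATE-L6-ASSEMBLY` §1
# Step I.2, ★★OWNER RULINGS №33 ∕ №34) — **PEN (L5b): THE LOCAL GAUGE COMPARISON OF THE DIVERGENCE TERM.**  Exact gauge covariance of print's `D*_{U₀}` ((3.8)) under a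
# simultaneous gauge change `(U₀, X) ↦ (U₀^σ, Ad_σX)`, first-order closeness `‖(D*_V − D*_1)X̃‖ ≤ 2√3·η⁻¹·δ·‖X̃‖` when `‖V(b) − 1‖ ≤ δ` on the support of `X`, and the
# resulting (L5b) row `|‖D*_{U₀}X̃‖² − ‖∂*(Ad_σX)~‖²| ≤ θ‖D*_{U₀}X̃‖² + (1 + θ⁻¹)·12·(η⁻¹δ)²·‖X̃‖²` whenever `‖U₀^σ(b) − 1‖ ≤ δ` on `supp X`.

Cell `ym3-torus` (HUMAN RULING D-0037: YM₃ on T³ is ladder rung R3 — NOT d = 4, NOT infinite volume, NOT a mass gap, NOT Clay).  Width seat `ym3-torus-px12` (gen 13),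
pen (L5b) claimed 2026-08-29 23:00Z under ★p1 g24's «(L5a)∕(L5b) open to a parallel hand» (22:57Z).  THEOREMS ONLY (0 `def`, 0 `sorry`);
`--supports stmt-QuantumFields-19200 --as helper`, count-neutral.  HONEST LABEL (№33 (6)): a supplier row of the curved γ-row line (LOD localisation), the `D*` third
of pen (L5) (`Q_k` third = routeR-w4 g25's (L5c), `Δ^η` third = (L5a)); nothing of (3.49), Thm 3.3∕3.11, `hGF`, `h349`, EX or the crux proved.

THE MATHEMATICS (print: [Balaban1985BackgroundPropagators] (3.8) p. 392 and the gauge covariance remark p. 393 «all the operators … are covariant with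
respect to gauge transformations»; [Balaban1985RegularSpaces] Lemma 1 p. 79 supplies the smallness `δ` in an axial gauge).
* COVARIANCE.  With `U₀^σ(b) = σ(b₋)U₀(b)σ(b₊)⁻¹` (`GaugeField.gaugeAct`) and `(Ad_σX)(b) = σ(b₋)X(b)σ(b₋)*`, the stencil (3.8) gives
  `(D*_{U₀^σ}(Ad_σX))(x) = σ(x)·(D*_{U₀}X)(x)·σ(x)*` (✓`Prop7CurvedJunctionCovariance.divB_gaugeAct_conj` read through ✓`Prop7DivSliceOfMemberDivSq.toL2S_symm_DstarL2_toL2_eq`),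
  hence `‖D*_{U₀^σ}(Ad_σX)~‖ = ‖D*_{U₀}X̃‖` and `‖(Ad_σX)~‖ = ‖X̃‖` (Frobenius norms are `Ad`-invariant).
* CLOSENESS.  `(D*_VX − D*_1X)(x) = η⁻¹Σ_μ (V(b_μ)*X(b_μ)V(b_μ) − X(b_μ))`, `b_μ = ⟨x − e_μ, μ⟩`: every bond is met ONCE (at its target), and
  `‖V*XV − X‖_F ≤ 2‖V − 1‖·‖X‖_F`; so `‖(D*_V − D*_1)X̃‖² ≤ 12·η⁻²·δ²·‖X̃‖²` as soon as `‖V(b) − 1‖ ≤ δ` on the bonds where `X ≠ 0` — NO condition off the support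
  (★p1's pin (P1): `D_U − D_1 = η⁻¹(Ad U − 1)·shift` is small only where `|U − 1| ≲ η`, i.e. inside the axial-gauge cube).
* THE ROW.  `|‖x‖² − ‖y‖²| ≤ θ‖x‖² + (1 + θ⁻¹)‖x − y‖²` at `x = D*_{U₀^σ}(Ad_σX)~`, `y = D*_1(Ad_σX)~`.
At the member of the line: `σ = g_j` the axial gauge of `U₀` on the cube `□̃_j ⊇ supp A_j`, `δ = 2·(R″L^{K−n})·ε₀η² = 2R″ε₀η`
(✓`Prop7FibreLevelSupLocalGauge.dist1_gaugeAct_axialGauge_le_of_mem_image` at `PlaqSmall (ε₀η²)`), so `12(η⁻¹δ)² = 48R″²ε₀²` — the `C_θ(ε₀R″)²` of the LOCATE.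

WHAT IS PROVED (ns `…Theorems.Prop7LocalDivergenceComparison`): §1 `abs_sq_norm_sub_sq_norm_le` (squares row); §2 Frobenius rows on `M₂(ℂ)` (`sum_normSq_mul_le_opNorm_sq_mul`,
`…_mul_le_mul_opNorm_sq`, `…_add_le`, `…_sum_le`, ★`sum_normSq_star_mul_mul_sub_le`, `sum_normSq_conj_eq`); §3 ★★`toL2S_symm_DstarL2_gaugeAct_conj` (covariance of (3.8)),
`norm_toL2_conj_eq`, `norm_toL2S_conj_eq`, ★★`norm_DstarL2_gaugeAct_conj_eq`; §4 ★★`normSq_DstarL2_sub_DstarL2_one_le` (closeness to flat on the support); §5 ★★★ the (L5b) row.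
HONEST SCOPE.  Algebra of the stencil (3.8) and Frobenius∕operator-norm bookkeeping; no estimate of Bałaban's is asserted; the axial-gauge smallness is a HYPOTHESIS `hV` here
(its inhabitant on a cube is the cited [B6] Lemma 1 reading, supplied by the (L6) assembler together with the cube letters).

References: T. Bałaban, CMP **99** (1985) 389–434 [Balaban1985BackgroundPropagators] ((3.8) p.392, (3.11) p.392, p.393); CMP **99** (1985) 75–102 [Balaban1985RegularSpaces]
(Lemma 1 (1.25) p.79); CMP **98** (1985) 17–51 [Balaban1985Averaging] ((18)–(20) p.21).
-/

set_option autoImplicit false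

noncomputable section

open scoped Matrix.Norms.L2Operator BigOperators Matrix

namespace Summit.QuantumFields.YangMills.Theorems.Prop7LocalDivergenceComparison

open Literature.MathematicalPhysics.QuantumFieldTheory.Balaban1983to89
open Literature.MathematicalPhysics.QuantumFieldTheory.Balaban1983to89.T3ContinuumYM3Torus
open T3SectALandauChart (eta eta_pos)
open B10Eq27TorusAxialLog (unitsField toUField)
open B9Eq39Adjoint (divB)
open B9TorusCalculus (torusT)
open Summit.QuantumFields.YangMills.Theorems.Prop7SectET3HilbertLetters (W₂ toL2 toL2S DstarL2)
open Summit.QuantumFields.YangMills.Theorems.Prop7DivSliceOfMemberDivSq (toL2S_symm_DstarL2_toL2_eq DstarL2_toL2_eq_toL2S)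
open Summit.QuantumFields.YangMills.Theorems.Prop7CurvedJunctionCovariance (divB_gaugeAct_conj)
open Summit.QuantumFields.YangMills.Theorems.Prop7PointLandauDivergence (divB_apply)
open Summit.QuantumFields.YangMills.Theorems.Prop7LaplaceAFlatLetters (norm_sq_toL2 norm_sq_toL2S)

/-! ## §1 The squares row -/

/-- **THE SQUARES ROW**: `|‖x‖² − ‖y‖²| ≤ θ‖x‖² + (1 + θ⁻¹)‖x − y‖²` for `θ > 0` (from `|‖x‖ − ‖y‖| ≤ ‖x − y‖` and `2‖x‖·‖x − y‖ ≤ θ‖x‖² + θ⁻¹‖x − y‖²`). [folklore] -/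
theorem abs_sq_norm_sub_sq_norm_le {E : Type*} [SeminormedAddCommGroup E] (x y : E) {θ : ℝ} (hθ : 0 < θ) :
    |‖x‖ ^ 2 - ‖y‖ ^ 2| ≤ θ * ‖x‖ ^ 2 + (1 + θ⁻¹) * ‖x - y‖ ^ 2 := by
  have hx := norm_nonneg x
  have hy := norm_nonneg y
  have hd := norm_nonneg (x - y)
  have h1 : ‖y‖ ≤ ‖x‖ + ‖x - y‖ := by
    calc ‖y‖ = ‖x - (x - y)‖ := by rw [sub_sub_cancel]
      _ ≤ ‖x‖ + ‖x - y‖ := norm_sub_le _ _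
  have h2 : ‖x‖ ≤ ‖y‖ + ‖x - y‖ := by
    calc ‖x‖ = ‖(x - y) + y‖ := by rw [sub_add_cancel]
      _ ≤ ‖x - y‖ + ‖y‖ := norm_add_le _ _
      _ = ‖y‖ + ‖x - y‖ := add_comm _ _
  -- AM–GM: `2‖x‖d ≤ θ‖x‖² + θ⁻¹d²`
  have hamgm : 2 * ‖x‖ * ‖x - y‖ ≤ θ * ‖x‖ ^ 2 + θ⁻¹ * ‖x - y‖ ^ 2 := by
    have hθ' : 0 < θ⁻¹ := inv_pos.mpr hθ
    have key : 0 ≤ θ * (‖x‖ - θ⁻¹ * ‖x - y‖) ^ 2 := mul_nonneg hθ.le (sq_nonneg _)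
    have hθθ : θ * θ⁻¹ = 1 := mul_inv_cancel₀ hθ.ne'
    nlinarith [key, hθθ, sq_nonneg ‖x - y‖]
  rw [abs_sub_le_iff]
  constructor
  · -- `‖x‖² − ‖y‖² ≤ …`
    nlinarith [h2, hx, hy, hd, hamgm, mul_nonneg hy hd, sq_nonneg (‖x‖ - ‖x - y‖)]
  · -- `‖y‖² − ‖x‖² ≤ …`
    nlinarith [h1, hx, hy, hd, hamgm, mul_nonneg hx hd]

/-! ## §2 Frobenius rows on `M₂(ℂ)` (entrywise `ℓ²` sums vs the operator norm of record) -/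

section Frobenius

/-- `Σ_{jk}|(AB)_{jk}|² ≤ ‖A‖²·Σ_{jk}|B_{jk}|²` (operator norm on the left factor). [cite: Balaban1985Averaging, (20) p.21] -/
theorem sum_normSq_mul_le_opNorm_sq_mul (A B : Matrix (Fin 2) (Fin 2) ℂ) :
    ∑ j, ∑ k, ‖(A * B) j k‖ ^ 2 ≤ ‖A‖ ^ 2 * ∑ j, ∑ k, ‖B j k‖ ^ 2 := by
  have h := MatrixNorms.nhsNormSq_mul_le A B
  unfold MatrixNorms.nhsNormSq at h
  rw [← mul_div_assoc] at h
  have hc : (0 : ℝ) < Fintype.card (Fin 2) := by norm_num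
  exact (div_le_div_iff_of_pos_right hc).mp h

/-- `Σ_{jk}|(AB)_{jk}|² ≤ ‖B‖²·Σ_{jk}|A_{jk}|²` (operator norm on the right factor). [cite: Balaban1985Averaging, (20) p.21] -/
theorem sum_normSq_mul_le_mul_opNorm_sq (A B : Matrix (Fin 2) (Fin 2) ℂ) :
    ∑ j, ∑ k, ‖(A * B) j k‖ ^ 2 ≤ ‖B‖ ^ 2 * ∑ j, ∑ k, ‖A j k‖ ^ 2 := by
  have h := MatrixNorms.nhsNorm_mul_le_nhsNorm_mul_opNorm A B
  have h0 : 0 ≤ MatrixNorms.nhsNorm (A * B) := MatrixNorms.nhsNorm_nonneg _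
  have h2 : MatrixNorms.nhsNormSq (A * B) ≤ MatrixNorms.nhsNormSq A * ‖B‖ ^ 2 := by
    rw [← MatrixNorms.nhsNorm_sq, ← MatrixNorms.nhsNorm_sq, ← mul_pow]
    exact pow_le_pow_left₀ h0 h 2
  unfold MatrixNorms.nhsNormSq at h2
  have hc : (0 : ℝ) < Fintype.card (Fin 2) := by norm_num
  rw [div_mul_eq_mul_div] at h2
  have h3 := (div_le_div_iff_of_pos_right hc).mp h2
  linarith [h3]

/-- `Σ_{jk}|(M + N)_{jk}|² ≤ 2Σ|M_{jk}|² + 2Σ|N_{jk}|²`. [folklore] -/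
theorem sum_normSq_add_le (M N : Matrix (Fin 2) (Fin 2) ℂ) :
    ∑ j, ∑ k, ‖(M + N) j k‖ ^ 2 ≤ 2 * ∑ j, ∑ k, ‖M j k‖ ^ 2 + 2 * ∑ j, ∑ k, ‖N j k‖ ^ 2 := by
  rw [Finset.mul_sum, Finset.mul_sum, ← Finset.sum_add_distrib]
  refine Finset.sum_le_sum fun j _ => ?_
  rw [Finset.mul_sum, Finset.mul_sum, ← Finset.sum_add_distrib]
  refine Finset.sum_le_sum fun k _ => ?_
  rw [Matrix.add_apply]
  nlinarith [norm_add_le (M j k) (N j k), norm_nonneg (M j k), norm_nonneg (N j k), norm_nonneg (M j k + N j k),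
    sq_nonneg (‖M j k‖ - ‖N j k‖)]

/-- `Σ_{jk}|(Σ_i M_i)_{jk}|² ≤ |ι|·Σ_i Σ_{jk}|(M_i)_{jk}|²` (Cauchy–Schwarz in the summation index). [folklore] -/
theorem sum_normSq_sum_le {ι : Type*} [Fintype ι] (M : ι → Matrix (Fin 2) (Fin 2) ℂ) :
    ∑ j, ∑ k, ‖(∑ i, M i) j k‖ ^ 2 ≤ Fintype.card ι * ∑ i, ∑ j, ∑ k, ‖M i j k‖ ^ 2 := by
  rw [Finset.sum_comm (s := Finset.univ (α := ι)), Finset.mul_sum]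
  refine Finset.sum_le_sum fun j _ => ?_
  rw [Finset.sum_comm (s := Finset.univ (α := ι)), Finset.mul_sum]
  refine Finset.sum_le_sum fun k _ => ?_
  rw [Matrix.sum_apply]
  calc ‖∑ i, M i j k‖ ^ 2 ≤ (∑ i, ‖M i j k‖) ^ 2 := pow_le_pow_left₀ (norm_nonneg _) (norm_sum_le _ _) 2
    _ = (∑ i, ‖M i j k‖ * 1) ^ 2 := by simp only [mul_one]
    _ ≤ (∑ i, ‖M i j k‖ ^ 2) * ∑ _i : ι, (1 : ℝ) ^ 2 := Finset.sum_mul_sq_le_sq_mul_sq _ _ _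
    _ = Fintype.card ι * ∑ i, ‖M i j k‖ ^ 2 := by simp [mul_comm]

/-- ★ **`Σ_{jk}|(V*XV − X)_{jk}|² ≤ 4‖V − 1‖²·Σ_{jk}|X_{jk}|²`** for `V ∈ SU(2)`: `V*XV − X = V*·(X(V − 1) − (V − 1)X)` and `‖V*‖ = 1`.
[cite: Balaban1985Averaging, (18)–(20) p.21] -/
theorem sum_normSq_star_mul_mul_sub_le (V : Matrix.specialUnitaryGroup (Fin 2) ℂ) (X : Matrix (Fin 2) (Fin 2) ℂ) :
    ∑ j, ∑ k, ‖(star (V : Matrix (Fin 2) (Fin 2) ℂ) * X * (V : Matrix (Fin 2) (Fin 2) ℂ) - X) j k‖ ^ 2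
      ≤ 4 * ‖(V : Matrix (Fin 2) (Fin 2) ℂ) - 1‖ ^ 2 * ∑ j, ∑ k, ‖X j k‖ ^ 2 := by
  set v : Matrix (Fin 2) (Fin 2) ℂ := (V : Matrix (Fin 2) (Fin 2) ℂ) with hv
  have hVV : star v * v = 1 := Matrix.mem_unitaryGroup_iff'.mp V.2.1
  have hid : star v * X * v - X = star v * (X * (v - 1) + -((v - 1) * X)) := by
    have : star v * (X * (v - 1) + -((v - 1) * X)) = star v * X * v - star v * X - (star v * v) * X + star v * X := by noncomm_ring
    rw [this, hVV]; noncomm_ring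
  have hstar : ‖star v‖ ≤ 1 := by
    rw [Matrix.star_eq_conjTranspose, Matrix.l2_opNorm_conjTranspose]
    exact (CStarRing.norm_coe_unitary ⟨v, Matrix.specialUnitaryGroup_le_unitaryGroup V.2⟩).le
  have hX : 0 ≤ ∑ j, ∑ k, ‖X j k‖ ^ 2 := Finset.sum_nonneg fun j _ => Finset.sum_nonneg fun k _ => sq_nonneg _
  calc ∑ j, ∑ k, ‖(star v * X * v - X) j k‖ ^ 2
        = ∑ j, ∑ k, ‖(star v * (X * (v - 1) + -((v - 1) * X))) j k‖ ^ 2 := by rw [hid]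
    _ ≤ ‖star v‖ ^ 2 * ∑ j, ∑ k, ‖(X * (v - 1) + -((v - 1) * X)) j k‖ ^ 2 := sum_normSq_mul_le_opNorm_sq_mul _ _
    _ ≤ 1 * ∑ j, ∑ k, ‖(X * (v - 1) + -((v - 1) * X)) j k‖ ^ 2 := by
        refine mul_le_mul_of_nonneg_right ?_ (Finset.sum_nonneg fun j _ => Finset.sum_nonneg fun k _ => sq_nonneg _)
        calc ‖star v‖ ^ 2 ≤ 1 ^ 2 := pow_le_pow_left₀ (norm_nonneg _) hstar 2
          _ = 1 := one_pow 2
    _ ≤ 2 * ∑ j, ∑ k, ‖(X * (v - 1)) j k‖ ^ 2 + 2 * ∑ j, ∑ k, ‖(-((v - 1) * X)) j k‖ ^ 2 := by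
        rw [one_mul]; exact sum_normSq_add_le _ _
    _ = 2 * ∑ j, ∑ k, ‖(X * (v - 1)) j k‖ ^ 2 + 2 * ∑ j, ∑ k, ‖((v - 1) * X) j k‖ ^ 2 := by
        simp only [Matrix.neg_apply, norm_neg]
    _ ≤ 2 * (‖v - 1‖ ^ 2 * ∑ j, ∑ k, ‖X j k‖ ^ 2) + 2 * (‖v - 1‖ ^ 2 * ∑ j, ∑ k, ‖X j k‖ ^ 2) := by
        gcongr
        · exact sum_normSq_mul_le_mul_opNorm_sq _ _
        · exact sum_normSq_mul_le_opNorm_sq_mul _ _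
    _ = 4 * ‖v - 1‖ ^ 2 * ∑ j, ∑ k, ‖X j k‖ ^ 2 := by ring

/-- **FROBENIUS NORMS ARE `Ad`-INVARIANT**: `Σ_{jk}|(σXσ*)_{jk}|² = Σ_{jk}|X_{jk}|²` for `σ ∈ SU(2)`. [cite: Balaban1985Averaging, (18) p.21] -/
theorem sum_normSq_conj_eq (σ : Matrix.specialUnitaryGroup (Fin 2) ℂ) (X : Matrix (Fin 2) (Fin 2) ℂ) :
    ∑ j, ∑ k, ‖((σ : Matrix (Fin 2) (Fin 2) ℂ) * X * star (σ : Matrix (Fin 2) (Fin 2) ℂ)) j k‖ ^ 2 = ∑ j, ∑ k, ‖X j k‖ ^ 2 := by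
  set s : Matrix (Fin 2) (Fin 2) ℂ := (σ : Matrix (Fin 2) (Fin 2) ℂ) with hs
  have hss : star s * s = 1 := Matrix.mem_unitaryGroup_iff'.mp σ.2.1
  have hss' : s * star s = 1 := Matrix.mem_unitaryGroup_iff.mp σ.2.1
  have hs1 : ‖s‖ ≤ 1 := (CStarRing.norm_coe_unitary ⟨s, Matrix.specialUnitaryGroup_le_unitaryGroup σ.2⟩).le
  have hs2 : ‖star s‖ ≤ 1 := by rw [Matrix.star_eq_conjTranspose, Matrix.l2_opNorm_conjTranspose]; exact hs1
  have hnn : ∀ Y : Matrix (Fin 2) (Fin 2) ℂ, 0 ≤ ∑ j, ∑ k, ‖Y j k‖ ^ 2 := fun Y => Finset.sum_nonneg fun j _ => Finset.sum_nonneg fun k _ => sq_nonneg _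
  -- one conjugation does not increase the sum …
  have hle : ∀ (u : Matrix (Fin 2) (Fin 2) ℂ) (Y : Matrix (Fin 2) (Fin 2) ℂ), ‖u‖ ≤ 1 → ‖star u‖ ≤ 1 →
      ∑ j, ∑ k, ‖(u * Y * star u) j k‖ ^ 2 ≤ ∑ j, ∑ k, ‖Y j k‖ ^ 2 := by
    intro u Y hu hu'
    calc ∑ j, ∑ k, ‖(u * Y * star u) j k‖ ^ 2 ≤ ‖star u‖ ^ 2 * ∑ j, ∑ k, ‖(u * Y) j k‖ ^ 2 := sum_normSq_mul_le_mul_opNorm_sq _ _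
      _ ≤ 1 * ∑ j, ∑ k, ‖(u * Y) j k‖ ^ 2 := by
          refine mul_le_mul_of_nonneg_right ?_ (hnn _)
          calc ‖star u‖ ^ 2 ≤ 1 ^ 2 := pow_le_pow_left₀ (norm_nonneg _) hu' 2
            _ = 1 := one_pow 2
      _ ≤ ‖u‖ ^ 2 * ∑ j, ∑ k, ‖Y j k‖ ^ 2 := by rw [one_mul]; exact sum_normSq_mul_le_opNorm_sq_mul _ _
      _ ≤ 1 * ∑ j, ∑ k, ‖Y j k‖ ^ 2 := by
          refine mul_le_mul_of_nonneg_right ?_ (hnn _)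
          calc ‖u‖ ^ 2 ≤ 1 ^ 2 := pow_le_pow_left₀ (norm_nonneg _) hu 2
            _ = 1 := one_pow 2
      _ = ∑ j, ∑ k, ‖Y j k‖ ^ 2 := one_mul _
  -- … and the inverse conjugation undoes it
  refine le_antisymm (hle s X hs1 hs2) ?_
  have hback : star s * (s * X * star s) * star (star s) = X := by
    rw [star_star]
    calc star s * (s * X * star s) * s = (star s * s) * X * (star s * s) := by noncomm_ring
      _ = X := by rw [hss, Matrix.one_mul, Matrix.mul_one]
  calc ∑ j, ∑ k, ‖X j k‖ ^ 2 = ∑ j, ∑ k, ‖(star s * (s * X * star s) * star (star s)) j k‖ ^ 2 := by rw [hback]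
    _ ≤ ∑ j, ∑ k, ‖(s * X * star s) j k‖ ^ 2 := hle (star s) _ hs2 (by rw [star_star]; exact hs1)

end Frobenius

/-! ## §3 Exact gauge covariance of (3.8) at the member -/

section Member

variable (F : T3Family) (n K : ℕ) (c₀ : ℝ) [Fact (0 < c₀)]

/-- ★★ **GAUGE COVARIANCE OF `D*_{U₀}` ON THE ROUTE CARRIERS**: for a gauge transformation `σ`, the background `U₀^σ = GaugeField.gaugeAct σ U₀` and the source-conjugated
vector field `(Ad_σX)(b) = σ(b₋)X(b)σ(b₋)*`, `(D*_{U₀^σ}(Ad_σX)~)(x) = σ(x)·(D*_{U₀}X̃)(x)·σ(x)*` read back on the sites.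
[cite: Balaban1985BackgroundPropagators, (3.8) p.392, p.393] -/
theorem toL2S_symm_DstarL2_gaugeAct_conj (σ : GaugeTransf (F.P K) 0 (Matrix.specialUnitaryGroup (Fin 2) ℂ))
    (U₀ : GaugeField (F.P K) 0 (Matrix.specialUnitaryGroup (Fin 2) ℂ)) (X : PBond (F.P K) 0 → Matrix (Fin 2) (Fin 2) ℂ) (x : Site (F.P K) 0) :
    (toL2S F K c₀).symm (DstarL2 F n K c₀ (GaugeField.gaugeAct σ U₀)
        (toL2 F K c₀ (fun b => (σ b.src : Matrix (Fin 2) (Fin 2) ℂ) * X b * star (σ b.src : Matrix (Fin 2) (Fin 2) ℂ)))) x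
      = (σ x : Matrix (Fin 2) (Fin 2) ℂ) * (toL2S F K c₀).symm (DstarL2 F n K c₀ U₀ (toL2 F K c₀ X)) x * star (σ x : Matrix (Fin 2) (Fin 2) ℂ) := by
  rw [toL2S_symm_DstarL2_toL2_eq, toL2S_symm_DstarL2_toL2_eq]
  dsimp only
  rw [divB_gaugeAct_conj σ U₀ (fun κ z => X ⟨z, κ⟩) x, Matrix.mul_smul, Matrix.smul_mul]

/-- **`‖(Ad_σX)~‖ = ‖X̃‖`** in the weighted `L²` of record. [cite: Balaban1985BackgroundPropagators, (3.11) p.392; Balaban1985Averaging, (18) p.21] -/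
theorem norm_toL2_conj_eq (σ : GaugeTransf (F.P K) 0 (Matrix.specialUnitaryGroup (Fin 2) ℂ)) (X : PBond (F.P K) 0 → Matrix (Fin 2) (Fin 2) ℂ) :
    ‖toL2 F K c₀ (fun b => (σ b.src : Matrix (Fin 2) (Fin 2) ℂ) * X b * star (σ b.src : Matrix (Fin 2) (Fin 2) ℂ))‖ = ‖toL2 F K c₀ X‖ := by
  have h : ‖toL2 F K c₀ (fun b => (σ b.src : Matrix (Fin 2) (Fin 2) ℂ) * X b * star (σ b.src : Matrix (Fin 2) (Fin 2) ℂ))‖ ^ 2 = ‖toL2 F K c₀ X‖ ^ 2 := by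
    rw [norm_sq_toL2, norm_sq_toL2]
    congr 1
    exact Finset.sum_congr rfl fun b _ => sum_normSq_conj_eq (σ b.src) (X b)
  exact (sq_eq_sq₀ (norm_nonneg _) (norm_nonneg _)).1 h

/-- **`‖λ̃^σ‖ = ‖λ̃‖`** for a site function conjugated sitewise. [cite: Balaban1985BackgroundPropagators, (3.11) p.392; Balaban1985Averaging, (18) p.21] -/
theorem norm_toL2S_conj_eq (σ : GaugeTransf (F.P K) 0 (Matrix.specialUnitaryGroup (Fin 2) ℂ)) (l : Site (F.P K) 0 → Matrix (Fin 2) (Fin 2) ℂ) :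
    ‖toL2S F K c₀ (fun x => (σ x : Matrix (Fin 2) (Fin 2) ℂ) * l x * star (σ x : Matrix (Fin 2) (Fin 2) ℂ))‖ = ‖toL2S F K c₀ l‖ := by
  have h : ‖toL2S F K c₀ (fun x => (σ x : Matrix (Fin 2) (Fin 2) ℂ) * l x * star (σ x : Matrix (Fin 2) (Fin 2) ℂ))‖ ^ 2 = ‖toL2S F K c₀ l‖ ^ 2 := by
    rw [norm_sq_toL2S, norm_sq_toL2S]
    congr 1
    exact Finset.sum_congr rfl fun x _ => sum_normSq_conj_eq (σ x) (l x)
  exact (sq_eq_sq₀ (norm_nonneg _) (norm_nonneg _)).1 h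

/-- ★★ **`‖D*_{U₀^σ}(Ad_σX)~‖ = ‖D*_{U₀}X̃‖`** — the divergence term of `T_U(A)` is a gauge invariant of the pair `(U₀, X)`.
[cite: Balaban1985BackgroundPropagators, (3.8) p.392, p.393] -/
theorem norm_DstarL2_gaugeAct_conj_eq (σ : GaugeTransf (F.P K) 0 (Matrix.specialUnitaryGroup (Fin 2) ℂ))
    (U₀ : GaugeField (F.P K) 0 (Matrix.specialUnitaryGroup (Fin 2) ℂ)) (X : PBond (F.P K) 0 → Matrix (Fin 2) (Fin 2) ℂ) :
    ‖DstarL2 F n K c₀ (GaugeField.gaugeAct σ U₀) (toL2 F K c₀ (fun b => (σ b.src : Matrix (Fin 2) (Fin 2) ℂ) * X b * star (σ b.src : Matrix (Fin 2) (Fin 2) ℂ)))‖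
      = ‖DstarL2 F n K c₀ U₀ (toL2 F K c₀ X)‖ := by
  have h1 : DstarL2 F n K c₀ (GaugeField.gaugeAct σ U₀)
        (toL2 F K c₀ (fun b => (σ b.src : Matrix (Fin 2) (Fin 2) ℂ) * X b * star (σ b.src : Matrix (Fin 2) (Fin 2) ℂ)))
      = toL2S F K c₀ (fun x => (σ x : Matrix (Fin 2) (Fin 2) ℂ) * (toL2S F K c₀).symm (DstarL2 F n K c₀ U₀ (toL2 F K c₀ X)) x * star (σ x : Matrix (Fin 2) (Fin 2) ℂ)) :=
    (LinearEquiv.symm_apply_eq _).mp (funext fun x => toL2S_symm_DstarL2_gaugeAct_conj F n K c₀ σ U₀ X x)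
  rw [h1, norm_toL2S_conj_eq, LinearEquiv.apply_symm_apply]

end Member

/-! ## §4 First-order closeness of `D*_V` to the flat `D*_1` on the support -/

section Closeness

variable (F : T3Family) (n K : ℕ) (c₀ : ℝ) [Fact (0 < c₀)]

/-- The flat stencil: `divB` at the trivial background is `Σ_μ (X(x − e_μ, μ) − X(x, μ))`. [cite: Balaban1985BackgroundPropagators, (3.8) p.392] -/
theorem divB_one_apply (X : PBond (F.P K) 0 → Matrix (Fin 2) (Fin 2) ℂ) (x : Site (F.P K) 0) :
    divB (torusT (F.P K) 0) (fun κ z => unitsField (toUField (1 : GaugeField (F.P K) 0 (Matrix.specialUnitaryGroup (Fin 2) ℂ))) ⟨z, κ⟩) (fun κ z => X ⟨z, κ⟩) x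
      = ∑ μ : Fin (F.P K).d, (X ⟨x.unshift μ, μ⟩ - X ⟨x, μ⟩) := by
  rw [divB_apply]
  refine Finset.sum_congr rfl fun μ _ => ?_
  have h1 : (((1 : GaugeField (F.P K) 0 (Matrix.specialUnitaryGroup (Fin 2) ℂ)) ⟨x.unshift μ, μ⟩ : Matrix.specialUnitaryGroup (Fin 2) ℂ) :
      Matrix (Fin 2) (Fin 2) ℂ) = 1 := rfl
  rw [h1, star_one, Matrix.one_mul, Matrix.mul_one]

/-- **THE DIFFERENCE STENCIL**: `(divB_V X − divB_1 X)(x) = Σ_μ (V(b_μ)*X(b_μ)V(b_μ) − X(b_μ))`, `b_μ = ⟨x − e_μ, μ⟩` — each bond met once, at its target.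
[cite: Balaban1985BackgroundPropagators, (3.8) p.392] -/
theorem divB_sub_divB_one_apply (V : GaugeField (F.P K) 0 (Matrix.specialUnitaryGroup (Fin 2) ℂ)) (X : PBond (F.P K) 0 → Matrix (Fin 2) (Fin 2) ℂ)
    (x : Site (F.P K) 0) :
    divB (torusT (F.P K) 0) (fun κ z => unitsField (toUField V) ⟨z, κ⟩) (fun κ z => X ⟨z, κ⟩) x
        - divB (torusT (F.P K) 0) (fun κ z => unitsField (toUField (1 : GaugeField (F.P K) 0 (Matrix.specialUnitaryGroup (Fin 2) ℂ))) ⟨z, κ⟩) (fun κ z => X ⟨z, κ⟩) x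
      = ∑ μ : Fin (F.P K).d, (star (V ⟨x.unshift μ, μ⟩ : Matrix (Fin 2) (Fin 2) ℂ) * X ⟨x.unshift μ, μ⟩ * (V ⟨x.unshift μ, μ⟩ : Matrix (Fin 2) (Fin 2) ℂ)
          - X ⟨x.unshift μ, μ⟩) := by
  rw [divB_apply, divB_one_apply, ← Finset.sum_sub_distrib]
  refine Finset.sum_congr rfl fun μ _ => ?_
  abel

/-- ★★ **FIRST-ORDER CLOSENESS OF `D*_V` TO THE FLAT `D*_1` ON THE SUPPORT** (★p1's pin (P1)): if `‖V(b) − 1‖ ≤ δ` on every bond where `X(b) ≠ 0`, then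
`‖D*_VX̃ − D*_1X̃‖² ≤ 12·η⁻²·δ²·‖X̃‖²` (`η = L^{−(K−n)}`; `12 = d·4`, `d = 3`).  No hypothesis off the support of `X`.
[cite: Balaban1985BackgroundPropagators, (3.8) p.392; Balaban1985RegularSpaces, Lemma 1 (1.25) p.79] -/
theorem normSq_DstarL2_sub_DstarL2_one_le (V : GaugeField (F.P K) 0 (Matrix.specialUnitaryGroup (Fin 2) ℂ)) (X : PBond (F.P K) 0 → Matrix (Fin 2) (Fin 2) ℂ)
    {δ : ℝ} (hV : ∀ b : PBond (F.P K) 0, X b ≠ 0 → ‖(V b : Matrix (Fin 2) (Fin 2) ℂ) - 1‖ ≤ δ) :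
    ‖DstarL2 F n K c₀ V (toL2 F K c₀ X) - DstarL2 F n K c₀ 1 (toL2 F K c₀ X)‖ ^ 2 ≤ 12 * ((eta F n K)⁻¹) ^ 2 * δ ^ 2 * ‖toL2 F K c₀ X‖ ^ 2 := by
  have hc : 0 < c₀ := Fact.out
  have hη : 0 < eta F n K := eta_pos F n K
  -- the difference as one site function
  set Dd : Site (F.P K) 0 → Matrix (Fin 2) (Fin 2) ℂ := fun x =>
    ∑ μ : Fin (F.P K).d, (star (V ⟨x.unshift μ, μ⟩ : Matrix (Fin 2) (Fin 2) ℂ) * X ⟨x.unshift μ, μ⟩ * (V ⟨x.unshift μ, μ⟩ : Matrix (Fin 2) (Fin 2) ℂ)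
      - X ⟨x.unshift μ, μ⟩) with hDd
  have hdiff : DstarL2 F n K c₀ V (toL2 F K c₀ X) - DstarL2 F n K c₀ 1 (toL2 F K c₀ X) = toL2S F K c₀ (fun x => (eta F n K)⁻¹ • Dd x) := by
    rw [DstarL2_toL2_eq_toL2S, DstarL2_toL2_eq_toL2S, ← map_sub]
    congr 1
    funext x
    rw [Pi.sub_apply, ← smul_sub, divB_sub_divB_one_apply]
  -- bondwise bound `Σ|V*XV − X|² ≤ 4δ²Σ|X|²` (trivial where `X = 0`)
  have hbond : ∀ b : PBond (F.P K) 0,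
      ∑ j, ∑ k, ‖(star (V b : Matrix (Fin 2) (Fin 2) ℂ) * X b * (V b : Matrix (Fin 2) (Fin 2) ℂ) - X b) j k‖ ^ 2 ≤ 4 * δ ^ 2 * ∑ j, ∑ k, ‖X b j k‖ ^ 2 := by
    intro b
    by_cases hX : X b = 0
    · simp [hX]
    · calc _ ≤ 4 * ‖(V b : Matrix (Fin 2) (Fin 2) ℂ) - 1‖ ^ 2 * ∑ j, ∑ k, ‖X b j k‖ ^ 2 := sum_normSq_star_mul_mul_sub_le (V b) (X b)
        _ ≤ 4 * δ ^ 2 * ∑ j, ∑ k, ‖X b j k‖ ^ 2 := by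
            have h1 : ‖(V b : Matrix (Fin 2) (Fin 2) ℂ) - 1‖ ^ 2 ≤ δ ^ 2 := pow_le_pow_left₀ (norm_nonneg _) (hV b hX) 2
            have h2 : 0 ≤ ∑ j, ∑ k, ‖X b j k‖ ^ 2 := Finset.sum_nonneg fun j _ => Finset.sum_nonneg fun k _ => sq_nonneg _
            nlinarith
  -- sitewise bound
  have hsite : ∀ x : Site (F.P K) 0, ∑ j, ∑ k, ‖Dd x j k‖ ^ 2
      ≤ 3 * ∑ μ : Fin (F.P K).d, (4 * δ ^ 2 * ∑ j, ∑ k, ‖X ⟨x.unshift μ, μ⟩ j k‖ ^ 2) := by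
    intro x
    calc ∑ j, ∑ k, ‖Dd x j k‖ ^ 2
          ≤ Fintype.card (Fin (F.P K).d) * ∑ μ : Fin (F.P K).d, ∑ j, ∑ k,
              ‖(star (V ⟨x.unshift μ, μ⟩ : Matrix (Fin 2) (Fin 2) ℂ) * X ⟨x.unshift μ, μ⟩ * (V ⟨x.unshift μ, μ⟩ : Matrix (Fin 2) (Fin 2) ℂ)
                - X ⟨x.unshift μ, μ⟩) j k‖ ^ 2 := sum_normSq_sum_le _
      _ = 3 * ∑ μ : Fin (F.P K).d, ∑ j, ∑ k,
              ‖(star (V ⟨x.unshift μ, μ⟩ : Matrix (Fin 2) (Fin 2) ℂ) * X ⟨x.unshift μ, μ⟩ * (V ⟨x.unshift μ, μ⟩ : Matrix (Fin 2) (Fin 2) ℂ)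
                - X ⟨x.unshift μ, μ⟩) j k‖ ^ 2 := by
            rw [Fintype.card_fin]; norm_num
      _ ≤ 3 * ∑ μ : Fin (F.P K).d, (4 * δ ^ 2 * ∑ j, ∑ k, ‖X ⟨x.unshift μ, μ⟩ j k‖ ^ 2) := by
            gcongr with μ _
            exact hbond ⟨x.unshift μ, μ⟩
  -- sum over the sites and reindex the bonds by their target
  have hre : ∑ x : Site (F.P K) 0, ∑ μ : Fin (F.P K).d, ∑ j, ∑ k, ‖X ⟨x.unshift μ, μ⟩ j k‖ ^ 2 = ∑ b : PBond (F.P K) 0, ∑ j, ∑ k, ‖X b j k‖ ^ 2 := by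
    rw [B10StarCount.sum_pbond, Finset.sum_comm]
    conv_rhs => rw [Finset.sum_comm]
    refine Finset.sum_congr rfl fun μ _ => ?_
    exact Fintype.sum_equiv (B10StarCount.shiftEquiv μ).symm (fun z => ∑ j, ∑ k, ‖X ⟨z.unshift μ, μ⟩ j k‖ ^ 2)
      (fun z => ∑ j, ∑ k, ‖X ⟨z, μ⟩ j k‖ ^ 2) (fun _ => rfl)
  have hsum : ∑ x : Site (F.P K) 0, ∑ j, ∑ k, ‖Dd x j k‖ ^ 2 ≤ 12 * δ ^ 2 * ∑ b : PBond (F.P K) 0, ∑ j, ∑ k, ‖X b j k‖ ^ 2 := by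
    calc ∑ x : Site (F.P K) 0, ∑ j, ∑ k, ‖Dd x j k‖ ^ 2
          ≤ ∑ x : Site (F.P K) 0, 3 * ∑ μ : Fin (F.P K).d, (4 * δ ^ 2 * ∑ j, ∑ k, ‖X ⟨x.unshift μ, μ⟩ j k‖ ^ 2) := Finset.sum_le_sum fun x _ => hsite x
      _ = 12 * δ ^ 2 * ∑ x : Site (F.P K) 0, ∑ μ : Fin (F.P K).d, ∑ j, ∑ k, ‖X ⟨x.unshift μ, μ⟩ j k‖ ^ 2 := by
            rw [Finset.mul_sum]
            refine Finset.sum_congr rfl fun x _ => ?_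
            rw [Finset.mul_sum, Finset.mul_sum]
            refine Finset.sum_congr rfl fun μ _ => ?_
            ring
      _ = 12 * δ ^ 2 * ∑ b : PBond (F.P K) 0, ∑ j, ∑ k, ‖X b j k‖ ^ 2 := by rw [hre]
  -- the weighted norms
  have hsm : ∀ x : Site (F.P K) 0, ∑ j, ∑ k, ‖((eta F n K)⁻¹ • Dd x) j k‖ ^ 2 = ((eta F n K)⁻¹) ^ 2 * ∑ j, ∑ k, ‖Dd x j k‖ ^ 2 := by
    intro x
    rw [Finset.mul_sum]
    refine Finset.sum_congr rfl fun j _ => ?_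
    rw [Finset.mul_sum]
    refine Finset.sum_congr rfl fun k _ => ?_
    rw [Matrix.smul_apply, norm_smul, mul_pow, Real.norm_of_nonneg (inv_nonneg.mpr hη.le)]
  rw [hdiff, norm_sq_toL2S, norm_sq_toL2]
  simp_rw [hsm]
  rw [← Finset.mul_sum]
  have h0 : 0 ≤ ((eta F n K)⁻¹) ^ 2 := sq_nonneg _
  calc c₀ * (((eta F n K)⁻¹) ^ 2 * ∑ x : Site (F.P K) 0, ∑ j, ∑ k, ‖Dd x j k‖ ^ 2)
        ≤ c₀ * (((eta F n K)⁻¹) ^ 2 * (12 * δ ^ 2 * ∑ b : PBond (F.P K) 0, ∑ j, ∑ k, ‖X b j k‖ ^ 2)) := by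
          exact mul_le_mul_of_nonneg_left (mul_le_mul_of_nonneg_left hsum h0) hc.le
    _ = 12 * ((eta F n K)⁻¹) ^ 2 * δ ^ 2 * (c₀ * ∑ b : PBond (F.P K) 0, ∑ j, ∑ k, ‖X b j k‖ ^ 2) := by ring

end Closeness

/-! ## §5 ★★★ The (L5b) row -/

section Row

variable (F : T3Family) (n K : ℕ) (c₀ : ℝ) [Fact (0 < c₀)]

/-- ★★★ **PEN (L5b) — THE LOCAL GAUGE COMPARISON OF THE DIVERGENCE TERM.**  For a background `U₀`, a gauge transformation `σ` with `‖U₀^σ(b) − 1‖ ≤ δ` on every bond where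
`X(b) ≠ 0` (at the member: the axial gauge of `U₀` on the cube `□̃_j ⊇ supp A_j`, `δ = 2R″ε₀η`), and any `θ > 0`:
`|‖D*_{U₀}X̃‖² − ‖D*_1(Ad_σX)~‖²| ≤ θ·‖D*_{U₀}X̃‖² + (1 + θ⁻¹)·(12·η⁻²·δ²)·‖X̃‖²`.
[cite: Balaban1985BackgroundPropagators, (3.8) p.392, p.393; Balaban1985RegularSpaces, Lemma 1 (1.25) p.79] -/
theorem abs_normSq_DstarL2_sub_normSq_DstarL2_one_conj_le (σ : GaugeTransf (F.P K) 0 (Matrix.specialUnitaryGroup (Fin 2) ℂ))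
    (U₀ : GaugeField (F.P K) 0 (Matrix.specialUnitaryGroup (Fin 2) ℂ)) (X : PBond (F.P K) 0 → Matrix (Fin 2) (Fin 2) ℂ) {δ θ : ℝ} (hθ : 0 < θ)
    (hV : ∀ b : PBond (F.P K) 0, X b ≠ 0 → ‖((GaugeField.gaugeAct σ U₀ b : Matrix.specialUnitaryGroup (Fin 2) ℂ) : Matrix (Fin 2) (Fin 2) ℂ) - 1‖ ≤ δ) :
    |‖DstarL2 F n K c₀ U₀ (toL2 F K c₀ X)‖ ^ 2
        - ‖DstarL2 F n K c₀ 1 (toL2 F K c₀ (fun b => (σ b.src : Matrix (Fin 2) (Fin 2) ℂ) * X b * star (σ b.src : Matrix (Fin 2) (Fin 2) ℂ)))‖ ^ 2|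
      ≤ θ * ‖DstarL2 F n K c₀ U₀ (toL2 F K c₀ X)‖ ^ 2 + (1 + θ⁻¹) * (12 * ((eta F n K)⁻¹) ^ 2 * δ ^ 2) * ‖toL2 F K c₀ X‖ ^ 2 := by
  set Xσ : PBond (F.P K) 0 → Matrix (Fin 2) (Fin 2) ℂ := fun b => (σ b.src : Matrix (Fin 2) (Fin 2) ℂ) * X b * star (σ b.src : Matrix (Fin 2) (Fin 2) ℂ) with hXσ
  rw [← norm_DstarL2_gaugeAct_conj_eq F n K c₀ σ U₀ X]
  have hsupp : ∀ b : PBond (F.P K) 0, Xσ b ≠ 0 → ‖((GaugeField.gaugeAct σ U₀ b : Matrix.specialUnitaryGroup (Fin 2) ℂ) : Matrix (Fin 2) (Fin 2) ℂ) - 1‖ ≤ δ := by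
    intro b hb
    refine hV b fun h0 => hb ?_
    simp [hXσ, h0]
  have hclose := normSq_DstarL2_sub_DstarL2_one_le F n K c₀ (GaugeField.gaugeAct σ U₀) Xσ hsupp
  rw [norm_toL2_conj_eq] at hclose
  have hsq := abs_sq_norm_sub_sq_norm_le (DstarL2 F n K c₀ (GaugeField.gaugeAct σ U₀) (toL2 F K c₀ Xσ)) (DstarL2 F n K c₀ 1 (toL2 F K c₀ Xσ)) hθ
  have hθ' : 0 ≤ 1 + θ⁻¹ := by positivity
  calc _ ≤ θ * ‖DstarL2 F n K c₀ (GaugeField.gaugeAct σ U₀) (toL2 F K c₀ Xσ)‖ ^ 2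
          + (1 + θ⁻¹) * ‖DstarL2 F n K c₀ (GaugeField.gaugeAct σ U₀) (toL2 F K c₀ Xσ) - DstarL2 F n K c₀ 1 (toL2 F K c₀ Xσ)‖ ^ 2 := hsq
    _ ≤ θ * ‖DstarL2 F n K c₀ (GaugeField.gaugeAct σ U₀) (toL2 F K c₀ Xσ)‖ ^ 2 + (1 + θ⁻¹) * (12 * ((eta F n K)⁻¹) ^ 2 * δ ^ 2 * ‖toL2 F K c₀ X‖ ^ 2) := by
          gcongr
    _ = _ := by ring

end Row

end Summit.QuantumFields.YangMills.Theorems.Prop7LocalDivergenceComparison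

end
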